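/-
Copyright (c) 2026 the pub-hodgecm-mathlib formalisation cell (harness21).  Prover seat hodgecm-mathlib-LH4-p06 (g9), req620 Track A «(D-RAM) FOUR-FRAME» squad
F0∕P3c∕LH4; the (β₂) road (R-36) «PURE-CELL LEDGER», β₂-BOARD v2 row (ROW), β₂ WORDS #13∕#16∕#17 of the sub-dealer LH4-p04 (g9): pieces (ROW-PURE-D) and
(ROW-REL-CLEAN) «EVERY CLEAN-REGIME ROW CELL IS PURE»; helper lane on h413 = stmt-HodgeConjecture-24833 (count-neutral).  2026-09-04.
-/
import Summits.HodgeConjecture.HodgeConjecture.Theorems.F0P3cDyRamRowCellOnShell             -- ★ p863084 (this seat): the SHELL half `latticeNearTransvShell_zero_of_row`; brings ★ p862651, ★ `…ShellLineModel`, ★ DEFS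
import Summits.HodgeConjecture.HodgeConjecture.Theorems.F0P3cDyRamConeCellPresentation        -- ★ p862869 (LH7-p09 (g2)): the junction `exists_presentation_of_mem_levelSetDep`
import Summits.HodgeConjecture.HodgeConjecture.Theorems.F0P3cDyRamRowVertexLettersOfTokens    -- ★ p862848 (LH4-p16 (g2)): `valueSet_rowVertex_eq_smul_xPlus_of_tokens`; brings ★ p861813's transports
import Summits.HodgeConjecture.HodgeConjecture.Theorems.F0P3cDyRamDiagonalCellCleanRegime     -- ★ p861813 (LH4-p19 (g0)): `exists_fixed_unit_hlam_of_depths` (ONE `σ`-fixed unit per row)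
import Summits.HodgeConjecture.HodgeConjecture.Theorems.F0P3cDyRamSmulXPlusLabel              -- ★ (LH4-p13 (g7)): `labelPlus_smul_xPlus_iff_exists_norm` (the norm-class bit)
import Summits.HodgeConjecture.HodgeConjecture.Theorems.F0P3cDyRamConeCellNormFibre            -- ★ (LH4-p12 lineage): `ncard_glueFibre_eq_natCard_normFibre_of_gen`, `exists_map_eq_glueUnit`, `exists_coneData_of_gen`
import Summits.HodgeConjecture.HodgeConjecture.Theorems.F0P3cDyRamConeCellDiagonalSize         -- ★ p861334 §4: `finsum_inter_sub_finsum_inter_eq_of_pure ∕ _neg_of_pure`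
import Summits.HodgeConjecture.HodgeConjecture.Theorems.F0P3cDyRamBeta2ConesOffRowOfPieces     -- ★ p862854 (LH4-p12 (g8)): the vocabulary of `OFF.letter.v1` (opens only)
import Summits.HodgeConjecture.HodgeConjecture.Theorems.F0P3cDyRamNormOneSqDepthParity        -- ★ (LH4 lineage): `normOneSq_depth_parity` (the parity gate)
import Summits.HodgeConjecture.HodgeConjecture.Theorems.F0P3cDyRamDatumParity                 -- ★ (LH4 lineage): `d_le_t_of_even`
import Literature.NumberTheory.LocalFields.ValuedCompleteIsAdicComplete                      -- ★ BRIDGE-AC (LH4-p02 (g12)): `isAdicComplete_valuedInteger_of_completeSpace`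
import Literature.NumberTheory.Automorphic.UnitaryGroupFormTransport                         -- ★ `conj_mem_unitaryGroupOfForm_iff`
import Literature.NumberTheory.Rogawski1990.EndoscopicEmbedding                              -- ★ `endoGL_mem_iff`, `endoForm_eq`
import HarnessLib

/-!
# Crux `H413`, line LH4 «(D-RAM) FOUR-FRAME» — the (β₂) road (R-36), β₂-BOARD v2 row (ROW): «EVERY CLEAN-REGIME ROW CELL IS PURE WITH THE ROW'S BIT» — the MASTER behind
# (ROW-PURE-D) ∕ (ROW-REL-CLEAN) in ‹OFF.letter.v1›'s one-literal general-block currency (`X(j,b)` = the two-finsum difference, `n(j,b)` = the unlabelled weighted size)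

Cell `hodgecm-mathlib` (D-0151), FLOOR 0, crux item H413 = `stmt-HodgeConjecture-24833`, route of record `HCCMUnconditional`; squad F0∕P3c∕LH4; lane
`--supports stmt-HodgeConjecture-24833 --as helper` (count-neutral; pays NO tier-0 row).  THEOREMS ONLY (no `def`, no instance, no notation, no `sorry`, default heartbeats);
★-only imports; states NO law; (β₂), ‹OFF› and ‹ROW› stay HYPOTHESES.  Binders: a SUBSET BY NAME AND BYTE of `OFF.letter.v1` (`F0/P3c/LH4/LH4-p04/g9/OFF.letter.v1.LH4p04g9.lean.txt`
c339e0c43a275fb0), the row letters `(b) (hb2 : 2 * b = m)`, the sub-dealer's clean letter `c + 2*d − 1 + d % 2 + m ≤ jl`, and THREE GATES in ℕ: `(hd0 : d % 2 = 0)` (see §1: on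
the `2b = m` row `d` is even as soon as `tE < m`), `(hmd : 3 * d ≤ m + 2)`, `(hgap : 3 * d + m ≤ jl + 2)` (★ p861813's fence `m* + d − 1 ≤ 2b, δ`; at `d = 2` both follow from the
clean letter at `c = 0`; at even `d ≥ 4` the strip `2d ≤ jl − m < 3d − 2` is NOT claimed).
MECHANISM.  ONE `σ`-fixed unit `fE` per ROW (★ p861813 `exists_fixed_unit_hlam_of_depths`: it reads `lam − jE u₀₀` and `b` only), and for EVERY glued vertex `L₃` over EVERY
member `Λ` of EVERY clean cell `(j, b)`: (shell) `L₃` is on the `(0, m*)`- and `(0, m_c)`-shells (★ p863084, this seat); (letter) its `ϖ^{m*}`-value set is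
`valueSetMod σ ϖ m* ((fE·h_W·N(ϖ^b g₀1)) • X₊)` (★ p862848, LH4-p16); (bit) hence `= valueSetMod σ ϖ m* X₊` iff `fE·h_W ∈ N(E^×)` (★ `labelPlus_smul_xPlus_iff_exists_norm`) —
ONE bit `β` for the whole row of the literal.  So the `Q₊`-subset of the cell is everything or nothing and the `Q₋′`-subset the complement (a member with non-zero weight HAS a
glued vertex: ★ `ncard_glueFibre_eq_natCard_normFibre_of_gen` + the weight letter `hf`), and ★ p861334 §4 gives `X(j,b) = ± n(j,b)` with the sign of `β` — uniformly in `j`.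
* §1 `line_entry_mul_map_eq_one` (`u₀₀σu₀₀ = 1` from `hΓ`, `hA`); THE PARITY GATES `depth_mod_two_eq` (`tE < m → m % 2 = d % 2`) and `antiDepth_mod_two_eq` (`tE < jl → jl % 2 = d % 2`)
  (★ `normOneSq_depth_parity` on `(M, Θ, jEϖ)` at the `Θ`-unitaries `lam∕jE u₀₀`, `lam∕ρlam`): on the fence `tE < m` the row `2b = m` is vacuous at odd `d` and `jl − m` is even.
* §2 `valueSet_rowVertex_eq_xPlus_iff` — THE BIT of one glued vertex (per vertex, light letters).
* §3 `cellDiff_eq_sign_mul_of_clean` — THE MASTER: `X(j,b) = (if ∃ z, z·σz = fE·h_W then 1 else −1) · n(j,b)` for every clean cell, `fE` an INPUT letter (the sibling file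
  `F0P3cDyRamRowCleanCells` feeds ★ p861813's `fE` and states (ROW-PURE-D) ∕ (ROW-REL-CLEAN) in WORD #16's bytes).
HONEST LABEL.  Count-neutral lattice bookkeeping; nothing printed is asserted; no census law is stated; `HC_CM` is proved only modulo the 7 printed citations (2 remaining named
inputs: hLiu418 = `stmt-HodgeConjecture-24832`, h413 = `stmt-HodgeConjecture-24833`) until rung 0 closes.
## References
* [Kottwitz1986BaseChangeUnits] R. E. Kottwitz, Compositio Math. 60 (1986): §1 pp. 240–241 (signed lattice counts cell by cell); [Jacobowitz1962] R. Jacobowitz, Amer. J. Math. 84 (1962): §4.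
* [Rogawski1990] J. D. Rogawski, Ann. of Math. Stud. 123 (1990): §4.9 Prop. 4.9.1 (b) p. 55; [Serre1979] J.-P. Serre, *Local Fields*, GTM 67: Ch. III §6 Prop. 12, Ch. V §3 Cor. 3.
* [LanglandsShelstad1987] R. P. Langlands, D. Shelstad, Math. Ann. 278 (1987): §1–§3 (κ-signs on a stable class).
-/

set_option autoImplicit false

noncomputable section

namespace Summit.HodgeConjecture.HodgeConjecture.Cruxes.H413.F0P3cDyRamRowCleanCellBit

open scoped Valued WithZero Matrix MatrixGroups Classical
open WithZero
open Literature.NumberTheory.Automorphic Literature.NumberTheory.Automorphic.HermitianLattice Literature.NumberTheory.Automorphic.UnitaryLatticeTree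
open Literature.NumberTheory.Automorphic.UnitaryThreeFourFrame (IsRamifiedQuadraticDatum)
open Literature.NumberTheory.Rogawski1990
open Literature.NumberTheory.LocalFields (isAdicComplete_valuedInteger_of_completeSpace)
open Summit.HodgeConjecture.HodgeConjecture.Cruxes.H413.F0P3cDyRamFourFramePieces
open Summit.HodgeConjecture.HodgeConjecture.Cruxes.H413.F0P3cDyRamFourFrameCensusDefs (LatticeInLevel LatticeNearTransvShell)
open Summit.HodgeConjecture.HodgeConjecture.Cruxes.H413.F0P3cDyRamStageOneBDefs (mcOfRecord)
open Summit.HodgeConjecture.HodgeConjecture.Cruxes.H413.F0P3cDyRamToricCensusDefs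
open Summit.HodgeConjecture.HodgeConjecture.Cruxes.H413.F0P3cDyRamRowCellOnShell (uniformizer_letters latticeNearTransvShell_zero_of_row)
open Summit.HodgeConjecture.HodgeConjecture.Cruxes.H413.F0P3cDyRamConeCellPresentation (exists_presentation_of_mem_levelSetDep)
open Summit.HodgeConjecture.HodgeConjecture.Cruxes.H413.F0P3cDyRamRowVertexLettersOfTokens (valueSet_rowVertex_eq_smul_xPlus_of_tokens)
open Summit.HodgeConjecture.HodgeConjecture.Cruxes.H413.F0P3cDyRamDiagonalCellCleanRegime (exists_fixed_unit_hlam_of_depths v_map_le_pow_iff v_eq_pow_of_map_eq)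
open Summit.HodgeConjecture.HodgeConjecture.Cruxes.H413.F0P3cDyRamSmulXPlusLabel (labelPlus_smul_xPlus_iff_exists_norm)
open Summit.HodgeConjecture.HodgeConjecture.Cruxes.H413.F0P3cDyRamConeLevelTransport (ncard_glueFibre_eq_natCard_normFibre_of_gen exists_map_eq_glueUnit exists_coneData_of_gen)
open Summit.HodgeConjecture.HodgeConjecture.Cruxes.H413.F0P3cDyRamConeCellDiagonalSize (finsum_inter_sub_finsum_inter_eq_of_pure finsum_inter_sub_finsum_inter_eq_neg_of_pure)
open Summit.HodgeConjecture.HodgeConjecture.Cruxes.H413.F0P3cDyRamTerminalCellOffShellCardTwo (map_sub_div_eq map_sub_mul_eq)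
open Summit.HodgeConjecture.HodgeConjecture.Cruxes.H413.F0P3cDyRamNormOneSqDepthParity (normOneSq_depth_parity)
open Literature.NumberTheory.LocalFields.WildQuadraticDatum (v_eq_one_of_v_mul_map_eq_one)
open Summit.HodgeConjecture.HodgeConjecture.Cruxes.H413.F0P3cDyRamDatumParity (d_le_t_of_even)

variable {E M : Type} [Field E] [Valued E ℤᵐ⁰] [Field M] [Valued M ℤᵐ⁰] {ρ Θ : M →+* M} {α : M}

/-! ## §1 The line entry is unitary; the parity gate -/

omit [Valued E ℤᵐ⁰] in
/-- **`u₀₀·σu₀₀ = 1` FROM THE FRAME**: `P₁·Γ·P₁⁻¹ ∈ U(σ, Φ₃)` with `ᵗσ(P₁)Φ₃P₁ = block(H₂, h_W)` and `Γ = endoGL (γ₂, u)` put `u` in `U(σ, (h_W))`, i.e. `σ(u₀₀)·h_W·u₀₀ = h_W` (`h_W ≠ 0`).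
[cite: Rogawski1990, §4.8 Case (a) p. 53] [cite: Jacobowitz1962, §4] -/
theorem line_entry_mul_map_eq_one (σ : E →+* E) {H₂ : Matrix (Fin 2) (Fin 2) E} {hW : E} (hhW0 : hW ≠ 0) {P₁ : GL (Fin 3) E} {γ₂ : GL (Fin 2) E} {u : GL (Fin 1) E}
    (hA : formCongr σ P₁ ((StdForm.antidiagonal 3).over E) = (!![H₂ 0 0, 0, H₂ 0 1; 0, hW, 0; H₂ 1 0, 0, H₂ 1 1] : Matrix (Fin 3) (Fin 3) E))
    (hΓ : P₁ * endoGL (γ₂, u) * P₁⁻¹ ∈ unitaryGroupOfForm σ ((StdForm.antidiagonal 3).over E)) :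
    (u : Matrix (Fin 1) (Fin 1) E) 0 0 * σ ((u : Matrix (Fin 1) (Fin 1) E) 0 0) = 1 := by
  have hblock : (!![H₂ 0 0, 0, H₂ 0 1; 0, hW, 0; H₂ 1 0, 0, H₂ 1 1] : Matrix (Fin 3) (Fin 3) E) = endoForm H₂ !![hW] := by
    rw [endoForm_eq]; rfl
  have h1 := (conj_mem_unitaryGroupOfForm_iff σ P₁ ((StdForm.antidiagonal 3).over E) (endoGL (γ₂, u))).1 hΓ
  rw [hA, hblock, endoGL_mem_iff] at h1
  have h2 := congrFun (congrFun (mem_unitaryGroupOfForm_iff.1 h1.2) 0) 0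
  simp only [Matrix.mul_apply, Fin.sum_univ_one, Matrix.transpose_apply, Matrix.map_apply, Matrix.of_apply, Matrix.cons_val_zero] at h2
  -- `σ(u₀₀)·hW·u₀₀ = hW`
  have h3 : ((u : Matrix (Fin 1) (Fin 1) E) 0 0 * σ ((u : Matrix (Fin 1) (Fin 1) E) 0 0)) * hW = 1 * hW := by linear_combination h2
  exact mul_right_cancel₀ hhW0 h3

omit [Valued E ℤᵐ⁰] in
/-- **THE PARITY GATE `m ≡ d (mod 2)` ON A DEEP ROW.**  Letters: the sheet datum on `M` (`IsRamifiedQuadraticDatum Θ (jEϖ) d tE`: `Θ`-fixed elements have EVEN order, `|jEϖ − Θ(jEϖ)| =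
|jEϖ|^d`, `|2| = |jEϖ|^{tE}`), the torus equations `Θ(lam)·lam = 1`, `u₀₀·σu₀₀ = 1` (`Θ ∘ jE = jE ∘ σ`), and `|lam − jE u₀₀| = exp(−m)` with `tE < m`.  THEN `m % 2 = d % 2`:
`ν := lam∕jE u₀₀` is `Θ`-unitary with `|ν − 1| = exp(−m) < |2|`, so `|ν + 1| = |2|` and `|ν² − 1| = exp(−(m + tE))`; ★ `normOneSq_depth_parity` gives `(m + tE) ≡ d`, and `tE` is even.
So the sub-dealer's row `2b = m` carries labelled cells only at EVEN `d`; at odd `d` it is vacuous once the fence `tE < m` is imposed. [cite: Serre1979, Ch. V §3 Cor. 3] -/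
theorem depth_mod_two_eq {σ : E →+* E} {ϖ : E} {d tE : ℕ} (jE : E →+* M) (hΘj : ∀ c, Θ (jE c) = jE (σ c))
    (hDM : IsRamifiedQuadraticDatum Θ (jE ϖ) d tE) [CompleteSpace M]
    {lam : M} (hΘlam : Θ lam * lam = 1) {u₀ : E} (huu : u₀ * σ u₀ = 1)
    {m : ℕ} (hm : Valued.v (lam - jE u₀) = exp (-(m : ℤ))) (htm : tE < m) : m % 2 = d % 2 := by
  obtain ⟨hΘΘ, hvΘ, hπ, heven, -, -, h2⟩ := id hDM
  have hu0 : jE u₀ ≠ 0 := fun h0 => by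
    have := congrArg jE huu; rw [map_mul, map_one, ← hΘj, h0, zero_mul] at this; exact zero_ne_one this
  have hΘu : jE u₀ * Θ (jE u₀) = 1 := by rw [hΘj, ← map_mul, huu, map_one]
  have hlamΘ : lam * Θ lam = 1 := by rw [mul_comm]; exact hΘlam
  set ν : M := lam / jE u₀ with hν
  have hνu : ν * Θ ν = 1 := by rw [hν, map_div₀, div_mul_div_comm, hlamΘ, hΘu, div_one]
  have hvu : Valued.v (jE u₀) = 1 := v_eq_one_of_v_mul_map_eq_one hvΘ (by rw [hΘu, Valuation.map_one])
  have hν1 : Valued.v (ν - 1) = exp (-(m : ℤ)) := by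
    rw [hν, div_sub_one hu0, Valuation.map_div, hvu, div_one, hm]
  -- `tE` is even and `|2| = exp(−tE)`
  have hv2 : Valued.v (2 : M) = exp (-(tE : ℤ)) := by rw [h2, hπ, ← exp_nsmul, nsmul_eq_mul, mul_neg, mul_one]
  have htE : tE % 2 = 0 := by
    obtain ⟨n, hn⟩ := heven 2 (map_ofNat Θ 2) (fun h0 => by rw [h0, map_zero] at hv2; exact (exp_ne_zero hv2.symm).elim)
    rw [hv2] at hn; have := exp_injective hn; omega
  -- `|ν + 1| = |2|` and `|ν·ν − 1| = exp(−(m + tE))`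
  have hν2 : Valued.v (ν + 1) = exp (-(tE : ℤ)) := by
    have e : ν + 1 = 2 + (ν - 1) := by ring
    rw [e, Valuation.map_add_eq_of_lt_left _ (by rw [hv2, hν1, exp_lt_exp]; omega), hv2]
  have hsq : Valued.v (ν * ν - 1) = Valued.v (jE ϖ) ^ (m + tE) := by
    rw [show ν * ν - 1 = (ν - 1) * (ν + 1) by ring, Valuation.map_mul, hν1, hν2, hπ, ← exp_add, ← exp_nsmul]
    congr 1; ring
  have hne : ν * ν ≠ 1 := fun h1 => by
    have := congrArg Valued.v (sub_eq_zero.2 h1); rw [hsq, Valuation.map_zero] at this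
    exact pow_ne_zero _ (by rw [hπ]; exact exp_ne_zero) this
  have hpar := normOneSq_depth_parity Θ (jE ϖ) d tE hDM ν hνu hne (m + tE) hsq
  omega

omit [Valued E ℤᵐ⁰] in
/-- **THE PARITY GATE FOR THE ANTI-DEPTH `jl ≡ d (mod 2)`.**  Same letters with `ρ` commuting with `Θ`: `lam∕ρlam` is `Θ`-unitary with `|lam∕ρlam − 1| = |lam − ρlam| = exp(−jl)`, so for
`tE < jl` ★ `normOneSq_depth_parity` gives `jl % 2 = d % 2` (`|lam| = 1`).  With `depth_mod_two_eq`: `jl − m` is EVEN on the fence. [cite: Serre1979, Ch. V §3 Cor. 3] -/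
theorem antiDepth_mod_two_eq {ϖ : E} {d tE : ℕ} (jE : E →+* M) (hΘρ : ∀ z, Θ (ρ z) = ρ (Θ z))
    (hDM : IsRamifiedQuadraticDatum Θ (jE ϖ) d tE) [CompleteSpace M]
    {lam : M} (hΘlam : Θ lam * lam = 1) (hvlam : Valued.v lam = 1) (hvρ : ∀ z, Valued.v (ρ z) = Valued.v z)
    {jl : ℕ} (hjl : Valued.v (lam - ρ lam) = exp (-(jl : ℤ))) (htj : tE < jl) : jl % 2 = d % 2 := by
  obtain ⟨hΘΘ, hvΘ, hπ, heven, -, -, h2⟩ := id hDM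
  have hlam0 : lam ≠ 0 := fun h0 => by rw [h0, Valuation.map_zero] at hvlam; exact zero_ne_one hvlam
  have hρlam0 : ρ lam ≠ 0 := (map_ne_zero ρ).2 hlam0
  have hlamΘ : lam * Θ lam = 1 := by rw [mul_comm]; exact hΘlam
  have hρΘ : ρ lam * Θ (ρ lam) = 1 := by rw [hΘρ, ← map_mul, hlamΘ, map_one]
  set ν : M := lam / ρ lam with hν
  have hνu : ν * Θ ν = 1 := by rw [hν, map_div₀, div_mul_div_comm, hlamΘ, hρΘ, div_one]
  have hν1 : Valued.v (ν - 1) = exp (-(jl : ℤ)) := by rw [hν, div_sub_one hρlam0, Valuation.map_div, hvρ, hvlam, div_one, hjl]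
  have hv2 : Valued.v (2 : M) = exp (-(tE : ℤ)) := by rw [h2, hπ, ← exp_nsmul, nsmul_eq_mul, mul_neg, mul_one]
  have htE : tE % 2 = 0 := by
    obtain ⟨n, hn⟩ := heven 2 (map_ofNat Θ 2) (fun h0 => by rw [h0, map_zero] at hv2; exact (exp_ne_zero hv2.symm).elim)
    rw [hv2] at hn; have := exp_injective hn; omega
  have hν2 : Valued.v (ν + 1) = exp (-(tE : ℤ)) := by
    have e : ν + 1 = 2 + (ν - 1) := by ring
    rw [e, Valuation.map_add_eq_of_lt_left _ (by rw [hv2, hν1, exp_lt_exp]; omega), hv2]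
  have hsq : Valued.v (ν * ν - 1) = Valued.v (jE ϖ) ^ (jl + tE) := by
    rw [show ν * ν - 1 = (ν - 1) * (ν + 1) by ring, Valuation.map_mul, hν1, hν2, hπ, ← exp_add, ← exp_nsmul]
    congr 1; ring
  have hne : ν * ν ≠ 1 := fun h1 => by
    have := congrArg Valued.v (sub_eq_zero.2 h1); rw [hsq, Valuation.map_zero] at this
    exact pow_ne_zero _ (by rw [hπ]; exact exp_ne_zero) this
  have hpar := normOneSq_depth_parity Θ (jE ϖ) d tE hDM ν hνu hne (jl + tE) hsq
  omega

/-! ## §2 The bit of one glued vertex over a clean row cell -/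

/-- **THE BIT OF A ROW VERTEX.**  ★ p862848's frame (block `(H₂, h_W)`, line model `(M, jE, ρ, Θ, α; φ, lam, h)`, a glued vertex `L` with tube `b` over `(B₂, w₀, g₀)` presented by
`Λ = φ(B₂) = x₀·𝒪_j`, `φ w₀ = Y⁻¹x₀`, `Y ∈ 𝒪_j` of level `b`), the lane-B tokens `|α − ρα| = 1`, `|jE a| = |a|`, the depths `|lam − jE u₀₀| = exp(−m)`, `|μ − ρμ| = exp(−jl)` on the ROW
`2b = m`, `d` even, and the ROW's clean `M`-letter `|μ + jE(fE·t₊·(ϖσϖ)^b)| ≤ |jEϖ|^{2b+m*}` for a `σ`-fixed unit `fE` (★ p861813); cell `b ≤ j`, `j + b + m* ≤ jl`, `d ≤ b`.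
THEN the `ϖ^{m*}`-value set of `Γ − 1` on `L` equals that of `X₊` IFF `fE·h_W` is a norm: ★ p862848 reads the letter as `VS_{m*}((fE·h_W·N(ϖ^b g₀1)) • X₊)` off the `jE(E)`-coordinates
of `μ`, ★ `labelPlus_smul_xPlus_iff_exists_norm` reads the bit, and the unit norm `N(ϖ^b g₀1)` drops. [cite: Rogawski1990, §4.9 Prop. 4.9.1 (b) p. 55] [cite: Serre1979, Ch. V §3 Cor. 3]
[cite: Jacobowitz1962, §4] [cite: LanglandsShelstad1987, §1–§3] -/
theorem valueSet_rowVertex_eq_xPlus_iff [CompleteSpace E] {σ : E →+* E} {ϖ : E} {d t : ℕ} (hD : IsRamifiedQuadraticDatum σ ϖ d t) (hd0 : d % 2 = 0)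
    (H₂ : Matrix (Fin 2) (Fin 2) E) {hW : E} (hhW : Valued.v hW = 1) (hhWσ : σ hW = hW)
    (jE : E →+* M) (hjv : ∀ c, Valued.v (jE c) ≤ 1 ↔ Valued.v c ≤ 1) (hjfix : ∀ z, ρ z = z ↔ ∃ c, jE c = z)
    (hρρ : ∀ x, ρ (ρ x) = x) (hvρ : ∀ x, Valued.v (ρ x) = Valued.v x) (hα : ρ α ≠ α) (hα1 : Valued.v α ≤ 1)
    (hint : ∀ z : M, Valued.v z ≤ 1 → Valued.v ((z - ρ z) / (α - ρ α)) ≤ 1)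
    (hΘΘ : ∀ x, Θ (Θ x) = x) (hΘρ : ∀ x, Θ (ρ x) = ρ (Θ x)) (hvΘ : ∀ x, Valued.v (Θ x) = Valued.v x) (hΘj : ∀ c, Θ (jE c) = jE (σ c))
    (hU : Valued.v (α - ρ α) = 1) (hjiso : ∀ a, Valued.v (jE a) = Valued.v a)
    (φ : (Fin 2 → E) →+ M) (hφs : ∀ (c : E) (x : Fin 2 → E), φ (c • x) = jE c * φ x)
    {γ₂ : GL (Fin 2) E} {lam h : M} (hφγ : ∀ x, φ ((γ₂ : Matrix (Fin 2) (Fin 2) E) *ᵥ x) = lam * φ x) (hh : h ≠ 0) (hΘh : Θ h = h)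
    (hform : ∀ x y, jE (pairing σ H₂ x y) = h * Θ (φ x) * φ y + ρ (h * Θ (φ x) * φ y))
    {L : Submodule 𝒪[E] (Fin 3 → E)} {b : ℕ} (hpr : ∀ x ∈ L, Valued.v (x 1) * Valued.v ϖ ^ b ≤ 1)
    (hintL : ∀ y ∈ L, Valued.v (pairing σ (!![H₂ 0 0, 0, H₂ 0 1; 0, hW, 0; H₂ 1 0, 0, H₂ 1 1] : Matrix (Fin 3) (Fin 3) E) y y) ≤ 1)
    {B₂ : Submodule 𝒪[E] (Fin 2 → E)} {w₀ : Fin 2 → E} {g₀ : Fin 3 → E}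
    (hB : B₂.map ((Matrix.toLin' (!![1, 0; 0, 0; 0, 1] : Matrix (Fin 3) (Fin 2) E)).restrictScalars 𝒪[E]) =
      L ⊓ LinearMap.ker ((LinearMap.proj (1 : Fin 3) : (Fin 3 → E) →ₗ[E] E).restrictScalars 𝒪[E]))
    (hg₀ : g₀ ∈ L) (hg₀1 : Valued.v (g₀ 1) * Valued.v ϖ ^ b = 1) (hprg : g₀ - Pi.single 1 (g₀ 1) = ![w₀ 0, 0, w₀ 1])
    (u : GL (Fin 1) E) (hum : Valued.v ((u : Matrix (Fin 1) (Fin 1) E) 0 0 - 1) ≤ Valued.v (ϖ ^ mstarOfRecord d))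
    {j : ℕ} {x₀ : M} (hx₀ : x₀ ≠ 0) {Λ : AddSubgroup M} (hBΛ : B₂.toAddSubgroup.map φ = Λ)
    (hΛx : ∀ x, x ∈ Λ ↔ ∃ ζ, IsOrd ρ α (jE ϖ ^ j) ζ ∧ x = x₀ * ζ) (hw₀Y : φ w₀ = (dualGen ρ Θ α (jE ϖ ^ j) h x₀)⁻¹ * x₀)
    (hYO : IsOrd ρ α (jE ϖ ^ j) (dualGen ρ Θ α (jE ϖ ^ j) h x₀)) (hYv : Valued.v (dualGen ρ Θ α (jE ϖ ^ j) h x₀) = Valued.v (jE ϖ) ^ b)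
    {m jl : ℕ} (hm : Valued.v (lam - jE ((u : Matrix (Fin 1) (Fin 1) E) 0 0)) = exp (-(m : ℤ)))
    (hjl : Valued.v ((lam - jE ((u : Matrix (Fin 1) (Fin 1) E) 0 0)) - ρ (lam - jE ((u : Matrix (Fin 1) (Fin 1) E) 0 0))) = exp (-(jl : ℤ)))
    (hb2 : 2 * b = m) {fE : E} (hσf : σ fE = fE) (hf1 : Valued.v fE = 1)
    (hμf : Valued.v (lam - jE ((u : Matrix (Fin 1) (Fin 1) E) 0 0) + jE (fE * ((ϖ - σ ϖ) * ((ϖ * σ ϖ) ^ ((d - d % 2) / 2))⁻¹) * (ϖ * σ ϖ) ^ b)) ≤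
      Valued.v (jE ϖ) ^ (2 * b + mstarOfRecord d))
    (hdb : d ≤ b) (hbj : b ≤ j) (hjl' : j + b + mstarOfRecord d ≤ jl) :
    ({z : E | ∃ y ∈ L, Valued.v ((ϖ ^ mstarOfRecord d)⁻¹ * (z - pairing σ (!![H₂ 0 0, 0, H₂ 0 1; 0, hW, 0; H₂ 1 0, 0, H₂ 1 1] : Matrix (Fin 3) (Fin 3) E) y
        ((((endoGL (γ₂, u) : GL (Fin 3) E) : Matrix (Fin 3) (Fin 3) E) - 1) *ᵥ y))) ≤ 1} = valueSetMod σ ϖ (mstarOfRecord d) (xPlus σ ϖ d)) ↔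
      ∃ z : E, z * σ z = fE * hW := by
  obtain ⟨hσσ, hvσ, hϖ, -, -, -, -⟩ := id hD
  obtain ⟨hϖ0, hϖlt, hjϖ0, hvjϖ0, hvjϖpos, hjϖlt, hjϖle⟩ := uniformizer_letters jE hjv hϖ
  have hπ : Valued.v (jE ϖ) = exp (-1 : ℤ) := by rw [hjiso, hϖ]
  have hπn : ∀ n : ℕ, Valued.v (jE ϖ) ^ n = exp (-(n : ℤ)) := fun n => by
    rw [hπ, ← exp_nsmul, nsmul_eq_mul, mul_neg, mul_one]
  haveI := isAdicComplete_valuedInteger_of_completeSpace (K := E) hϖ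
  set μ : M := lam - jE ((u : Matrix (Fin 1) (Fin 1) E) 0 0) with hμdef
  -- the `jE(E)`-coordinates of `μ`
  obtain ⟨μb, hμb⟩ := (hjfix _).1 (map_sub_div_eq (α := α) hρρ μ)
  obtain ⟨μa, hμa⟩ := (hjfix _).1 (map_sub_mul_eq hρρ hα μ)
  have hμab : μ = jE μa + jE μb * α := by rw [hμa, hμb]; ring
  have hμbv : Valued.v (jE μb) = Valued.v (jE ϖ) ^ jl := by rw [hμb, Valuation.map_div, hjl, hU, div_one, hπn]
  have hmjl : m + 1 ≤ jl := by have := hD.2.2.2.2.2.1; simp only [mstarOfRecord] at hjl'; omega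
  have hμbα : Valued.v (jE μb * α) < Valued.v μ := by
    rw [Valuation.map_mul, hμbv, hm, hπn]
    calc exp (-(jl : ℤ)) * Valued.v α ≤ exp (-(jl : ℤ)) * 1 := mul_le_mul_right hα1 _
      _ < exp (-(m : ℤ)) := by rw [mul_one, exp_lt_exp]; omega
  have hμav : Valued.v μa = Valued.v ϖ ^ (2 * b + d % 2) := by
    rw [hd0, add_zero]
    refine v_eq_pow_of_map_eq jE hjv hϖ0 ?_
    rw [show jE μa = μ - jE μb * α by rw [hμab]; ring, Valuation.map_sub_eq_of_lt_left _ hμbα, hm, hπn, hb2]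
  have hμaE : Valued.v (μa + fE * ((ϖ - σ ϖ) * ((ϖ * σ ϖ) ^ ((d - d % 2) / 2))⁻¹) * (ϖ * σ ϖ) ^ b) ≤ Valued.v ϖ ^ (2 * b + mstarOfRecord d) := by
    refine (v_map_le_pow_iff jE hjv hϖ0 _ _).1 ?_
    have e : jE (μa + fE * ((ϖ - σ ϖ) * ((ϖ * σ ϖ) ^ ((d - d % 2) / 2))⁻¹) * (ϖ * σ ϖ) ^ b) =
        (μ + jE (fE * ((ϖ - σ ϖ) * ((ϖ * σ ϖ) ^ ((d - d % 2) / 2))⁻¹) * (ϖ * σ ϖ) ^ b)) - jE μb * α := by rw [map_add, hμab]; ring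
    rw [e]
    refine (Valuation.map_sub _ _ _).trans (max_le hμf ?_)
    rw [Valuation.map_mul, hμbv]
    calc Valued.v (jE ϖ) ^ jl * Valued.v α ≤ Valued.v (jE ϖ) ^ jl * 1 := mul_le_mul_right hα1 _
      _ ≤ Valued.v (jE ϖ) ^ (2 * b + mstarOfRecord d) := by rw [mul_one]; exact pow_le_pow_right_of_le_one' hjϖle (by omega)
  -- ★ p862848: the letter of the vertex
  rw [valueSet_rowVertex_eq_smul_xPlus_of_tokens hD H₂ hhW jE hjv hjfix hρρ hvρ hα hα1 hint hΘΘ hΘρ hvΘ hΘj φ hφs hφγ hh hΘh hform hpr hintL hB hg₀ hg₀1 hprg u hum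
    hx₀ hBΛ hΛx hw₀Y hYO hYv hμab hμav hμbv hf1 hμaE le_rfl hdb hbj hjl']
  -- ★ the bit of a `σ`-fixed unit multiple of `X₊`
  set g : E := ϖ ^ b * g₀ 1 with hg
  have hg1 : Valued.v g = 1 := by rw [hg, Valuation.map_mul, Valuation.map_pow, mul_comm]; exact hg₀1
  have hgv0 : g ≠ 0 := fun h0 => by rw [h0, Valuation.map_zero] at hg1; exact zero_ne_one hg1
  have hσg0 : σ g ≠ 0 := (map_ne_zero σ).2 hgv0
  have he : σ (fE * hW * (g * σ g)) = fE * hW * (g * σ g) := by rw [map_mul, map_mul, map_mul, hσf, hhWσ, hσσ]; ring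
  have he1 : Valued.v (fE * hW * (g * σ g)) = 1 := by
    rw [Valuation.map_mul, Valuation.map_mul, Valuation.map_mul, hf1, hhW, hvσ, hg1]; simp
  have key := labelPlus_smul_xPlus_iff_exists_norm hD he he1
  rw [LabelPlus] at key
  refine key.trans ⟨?_, ?_⟩
  · rintro ⟨z, hz⟩
    refine ⟨z / g, ?_⟩
    rw [map_div₀, div_mul_div_comm, hz]; field_simp
  · rintro ⟨z, hz⟩
    exact ⟨z * g, by rw [map_mul, show z * g * (σ z * σ g) = z * σ z * (g * σ g) by ring, hz]⟩

/-! ## §3 THE MASTER: every clean row cell is pure, with the sign of ONE bit per row -/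

/-- **THE MASTER — «A CLEAN ROW CELL IS PURE WITH THE ROW'S BIT».**  Binders: a SUBSET of ‹OFF.letter.v1›'s one-literal general block (by name and byte), the row `2b = m` with
`d` even and the fence `3d ≤ m + 2`, the ROW's clean `M`-letter for a `σ`-fixed unit `fE` (`|μ + jE(fE·t₊·(ϖσϖ)^b)| ≤ |jEϖ|^{2b+m*}`, ★ p861813 — an INPUT here, so that one `fE`
serves every cell of the row), and a cell `(j, b)` with `b ≤ j`, `j + b + m* ≤ jl`.  THEN `X(j,b) = (if ∃ z, z·σz = fE·h_W then 1 else −1) · n(j,b)` — `X` = ‹OFF›'s two-finsum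
difference VERBATIM, `n` the unlabelled weighted size.  §2 gives the same bit on every glued vertex, ★ p863084 puts every vertex on both shells, ★ `ncard_glueFibre_eq_natCard_normFibre_of_gen`
+ `hf` give a glued vertex to every weighted member, and ★ p861334 §4 folds the cell. [cite: Kottwitz1986BaseChangeUnits, §1 pp. 240–241] [cite: Rogawski1990, §4.9 Prop. 4.9.1 (b) p. 55]
[cite: Jacobowitz1962, §4] [cite: Serre1979, Ch. V §3 Cor. 3] -/
theorem cellDiff_eq_sign_mul_of_clean
    [CompleteSpace E] [IsDiscreteValuationRing 𝒪[E]]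
    (σ : E →+* E) (ϖ : E) (d tE : ℕ) (hD : IsRamifiedQuadraticDatum σ ϖ d tE)
    (jE : E →+* M) (ρ Θ : M →+* M) (α lam : M)
    (hρρ : ∀ z, ρ (ρ z) = z) (hvρ : ∀ z, Valued.v (ρ z) = Valued.v z)
    (hjv : ∀ a, Valued.v (jE a) ≤ 1 ↔ Valued.v a ≤ 1) (hjfix : ∀ z : M, ρ z = z ↔ ∃ a, jE a = z) (hΘj : ∀ a, Θ (jE a) = jE (σ a))
    (hΘΘ : ∀ z, Θ (Θ z) = z) (hΘρ : ∀ z, Θ (ρ z) = ρ (Θ z)) (hvΘ : ∀ z, Valued.v (Θ z) = Valued.v z)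
    (hα : ρ α ≠ α) (hα1 : Valued.v α ≤ 1) (hint : ∀ z : M, Valued.v z ≤ 1 → Valued.v ((z - ρ z) / (α - ρ α)) ≤ 1)
    (hvlam : Valued.v lam = 1) (hU : Valued.v (α - ρ α) = 1) (hjiso : ∀ a, Valued.v (jE a) = Valued.v a)
    (hjpow : ∀ (t : E) (n : ℤ), Valued.v (jE t) = Valued.v (jE ϖ) ^ n ↔ Valued.v t = Valued.v ϖ ^ n)
    (hϖmax : ∀ t : M, ρ t = t → Valued.v t < 1 → Valued.v t ≤ Valued.v (jE ϖ))
    (γ₂ : GL (Fin 2) E) (u : GL (Fin 1) E) (m jl : ℕ) (hm : Valued.v (lam - jE ((u : Matrix (Fin 1) (Fin 1) E) 0 0)) = WithZero.exp (-(m : ℤ)))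
    (hjl : Valued.v ((lam - jE ((u : Matrix (Fin 1) (Fin 1) E) 0 0)) - ρ (lam - jE ((u : Matrix (Fin 1) (Fin 1) E) 0 0))) = WithZero.exp (-(jl : ℤ)))
    (hum : Valued.v (((u : Matrix (Fin 1) (Fin 1) E) 0 0) - 1) ≤ Valued.v (ϖ ^ mstarOfRecord d))
    (H₂ : Matrix (Fin 2) (Fin 2) E) (hW : E) (hH₂ : IsUnit H₂.det) (hH₂σ : (H₂.map σ)ᵀ = H₂) (hhW : Valued.v hW = 1) (hhWσ : σ hW = hW)
    (φ : (Fin 2 → E) →+ M) (h : M) (hφs : ∀ (c : E) (x : Fin 2 → E), φ (c • x) = jE c * φ x) (hφi : Function.Injective φ) (hφo : Function.Surjective φ)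
    (hφγ : ∀ x, φ ((γ₂ : Matrix (Fin 2) (Fin 2) E).mulVec x) = lam * φ x)
    (hform : ∀ x y, jE (pairing σ H₂ x y) = h * Θ (φ x) * φ y + ρ (h * Θ (φ x) * φ y)) (hΘh : Θ h = h) (hh : h ≠ 0)
    (f : ℕ → ℕ → AddSubgroup M → ℕ)
    (hf : ∀ (b j : ℕ) (Λ : AddSubgroup M) (x₀ : M) (r : E), 1 ≤ b → x₀ ≠ 0 → (∀ x, x ∈ Λ ↔ ∃ z, IsOrd ρ α (jE ϖ ^ j) z ∧ x = x₀ * z) →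
      IsOrd ρ α (jE ϖ ^ j) (dualGen ρ Θ α (jE ϖ ^ j) h x₀) → ¬ IsOrd ρ α (jE ϖ ^ j) (dualGen ρ Θ α (jE ϖ ^ j) h x₀ / jE ϖ) → Valued.v (dualGen ρ Θ α (jE ϖ ^ j) h x₀) = Valued.v (jE ϖ) ^ b →
      (∀ b', (∀ x ∈ Λ, Valued.v (h * Θ x * b' + ρ (h * Θ x * b')) ≤ 1) → (lam - jE ((u : Matrix (Fin 1) (Fin 1) E) 0 0)) * b' ∈ Λ) → IsOrd ρ α (jE ϖ ^ j) lam →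
      jE r = glueUnit ρ Θ α (jE ϖ ^ j) h (jE ϖ) (jE hW) x₀ b →
      f b j Λ = Nat.card {x : 𝒪[E] ⧸ 𝓂[E] ^ (2 * b) // ∃ u' : 𝒪[E], Ideal.Quotient.mk (𝓂[E] ^ (2 * b)) u' = x ∧ Valued.v ((u' : E) * σ u' - r) ≤ Valued.v (ϖ ^ (2 * b))})
    (b : ℕ) (hb2 : 2 * b = m) (hd0 : d % 2 = 0) (hmd : 3 * d ≤ m + 2)
    {fE : E} (hσf : σ fE = fE) (hf1 : Valued.v fE = 1)
    (hμf : Valued.v (lam - jE ((u : Matrix (Fin 1) (Fin 1) E) 0 0) + jE (fE * ((ϖ - σ ϖ) * ((ϖ * σ ϖ) ^ ((d - d % 2) / 2))⁻¹) * (ϖ * σ ϖ) ^ b)) ≤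
      Valued.v (jE ϖ) ^ (2 * b + mstarOfRecord d))
    {j : ℕ} (hbj : b ≤ j) (hjl' : j + b + mstarOfRecord d ≤ jl) :
                ((∑ᶠ Λ ∈ levelSetDep ρ Θ α (jE ϖ) h j b (lam - jE ((u : Matrix (Fin 1) (Fin 1) E) 0 0)) ∩
                      {Λ | ∃ B : Submodule 𝒪[E] (Fin 2 → E), B.toAddSubgroup.map φ = Λ ∧
                        ∃ L₃ : Submodule 𝒪[E] (Fin 3 → E), IsSelfDualLattice σ ϖ (!![H₂ 0 0, 0, H₂ 0 1; 0, hW, 0; H₂ 1 0, 0, H₂ 1 1] : Matrix (Fin 3) (Fin 3) E) L₃ ∧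
                          L₃ ⊓ LinearMap.ker ((LinearMap.proj (1 : Fin 3) : (Fin 3 → E) →ₗ[E] E).restrictScalars 𝒪[E]) =
                            B.map ((Matrix.toLin' (!![1, 0; 0, 0; 0, 1] : Matrix (Fin 3) (Fin 2) E)).restrictScalars 𝒪[E]) ∧
                          (∀ c : E, (Pi.single 1 c : Fin 3 → E) ∈ L₃ ↔ Valued.v c ≤ Valued.v ϖ ^ b) ∧
                          (LatticeNearTransvShell ϖ (d % 2) (mstarOfRecord d) ((((endoGL (γ₂, u) : GL (Fin 3) E) : Matrix (Fin 3) (Fin 3) E) - 1)) L₃ ∧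
                            {z : E | ∃ y ∈ L₃, Valued.v ((ϖ ^ (mstarOfRecord d))⁻¹ * (z - pairing σ (!![H₂ 0 0, 0, H₂ 0 1; 0, hW, 0; H₂ 1 0, 0, H₂ 1 1] : Matrix (Fin 3) (Fin 3) E) y (((((endoGL (γ₂, u) : GL (Fin 3) E) : Matrix (Fin 3) (Fin 3) E) - 1)) *ᵥ y))) ≤ 1} =
                              valueSetMod σ ϖ (mstarOfRecord d) (xPlus σ ϖ d))}, f b j Λ : ℕ) : ℤ) -
                  ((∑ᶠ Λ ∈ levelSetDep ρ Θ α (jE ϖ) h j b (lam - jE ((u : Matrix (Fin 1) (Fin 1) E) 0 0)) ∩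
                      {Λ | ∃ B : Submodule 𝒪[E] (Fin 2 → E), B.toAddSubgroup.map φ = Λ ∧
                        ∃ L₃ : Submodule 𝒪[E] (Fin 3 → E), IsSelfDualLattice σ ϖ (!![H₂ 0 0, 0, H₂ 0 1; 0, hW, 0; H₂ 1 0, 0, H₂ 1 1] : Matrix (Fin 3) (Fin 3) E) L₃ ∧
                          L₃ ⊓ LinearMap.ker ((LinearMap.proj (1 : Fin 3) : (Fin 3 → E) →ₗ[E] E).restrictScalars 𝒪[E]) =
                            B.map ((Matrix.toLin' (!![1, 0; 0, 0; 0, 1] : Matrix (Fin 3) (Fin 2) E)).restrictScalars 𝒪[E]) ∧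
                          (∀ c : E, (Pi.single 1 c : Fin 3 → E) ∈ L₃ ↔ Valued.v c ≤ Valued.v ϖ ^ b) ∧
                          (LatticeNearTransvShell ϖ (d % 2) (mcOfRecord d) ((((endoGL (γ₂, u) : GL (Fin 3) E) : Matrix (Fin 3) (Fin 3) E) - 1)) L₃ ∧
                            ¬ {z : E | ∃ y ∈ L₃, Valued.v ((ϖ ^ (mstarOfRecord d))⁻¹ * (z - pairing σ (!![H₂ 0 0, 0, H₂ 0 1; 0, hW, 0; H₂ 1 0, 0, H₂ 1 1] : Matrix (Fin 3) (Fin 3) E) y (((((endoGL (γ₂, u) : GL (Fin 3) E) : Matrix (Fin 3) (Fin 3) E) - 1)) *ᵥ y))) ≤ 1} =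
                              valueSetMod σ ϖ (mstarOfRecord d) (xPlus σ ϖ d))}, f b j Λ : ℕ) : ℤ) =
      (if ∃ z : E, z * σ z = fE * hW then (1 : ℤ) else -1) * ((∑ᶠ Λ ∈ levelSetDep ρ Θ α (jE ϖ) h j b (lam - jE ((u : Matrix (Fin 1) (Fin 1) E) 0 0)), f b j Λ : ℕ) : ℤ) := by
  classical
  obtain ⟨hσσ, hvσ, hϖ, -, -, hd1, h2t⟩ := id hD
  obtain ⟨hϖ0, hϖlt, hjϖ0, hvjϖ0, hvjϖpos, hjϖlt, hjϖle⟩ := uniformizer_letters jE hjv hϖ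
  have hπ : Valued.v (jE ϖ) = exp (-1 : ℤ) := by rw [hjiso, hϖ]
  have hπn : ∀ n : ℕ, Valued.v (jE ϖ) ^ n = exp (-(n : ℤ)) := fun n => by rw [hπ, ← exp_nsmul, nsmul_eq_mul, mul_neg, mul_one]
  have hm1 : mstarOfRecord d = 2 * d - 1 := by simp only [mstarOfRecord]; omega
  have hmc : mcOfRecord d = 3 * d - 2 := by simp only [mcOfRecord, mstarOfRecord]; omega
  have hdt : d ≤ tE := d_le_t_of_even hD hd0
  have hb1 : 1 ≤ b := by omega
  set μ : M := lam - jE ((u : Matrix (Fin 1) (Fin 1) E) 0 0) with hμdef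
  have hμ2b : Valued.v μ = Valued.v (jE ϖ) ^ (2 * b) := by rw [hm, hπn, hb2]
  have hlamj : IsOrd ρ α (jE ϖ ^ j) lam := by
    refine ⟨hvlam.le, ?_⟩
    have e : lam - ρ lam = μ - ρ μ := by rw [hμdef, map_sub, (hjfix _).2 ⟨_, rfl⟩]; ring
    rw [e, hjl, Valuation.map_mul, Valuation.map_pow, hU, mul_one, hπn, exp_le_exp]; omega
  have hanti : Valued.v (μ - ρ μ) ≤ Valued.v (jE ϖ ^ j * (α - ρ α)) * Valued.v (jE ϖ) ^ (b + 1) := by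
    rw [hjl, Valuation.map_mul, Valuation.map_pow, hU, mul_one, ← pow_add, hπn, exp_le_exp]; omega
  have hcb : Valued.v (jE ϖ ^ j) ≤ Valued.v (jE ϖ) ^ b := by rw [Valuation.map_pow]; exact pow_le_pow_right_of_le_one' hjϖle hbj
  have hum' : Valued.v (((u : Matrix (Fin 1) (Fin 1) E) 0 0) - 1) ≤ Valued.v ϖ ^ mstarOfRecord d := by rwa [Valuation.map_pow] at hum
  -- PER VERTEX: shells + bit
  have hvert : ∀ Λ ∈ levelSetDep ρ Θ α (jE ϖ) h j b μ, ∀ (B : Submodule 𝒪[E] (Fin 2 → E)) (L₃ : Submodule 𝒪[E] (Fin 3 → E)),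
      B.toAddSubgroup.map φ = Λ → IsSelfDualLattice σ ϖ (!![H₂ 0 0, 0, H₂ 0 1; 0, hW, 0; H₂ 1 0, 0, H₂ 1 1] : Matrix (Fin 3) (Fin 3) E) L₃ →
      L₃ ⊓ LinearMap.ker ((LinearMap.proj (1 : Fin 3) : (Fin 3 → E) →ₗ[E] E).restrictScalars 𝒪[E]) =
        B.map ((Matrix.toLin' (!![1, 0; 0, 0; 0, 1] : Matrix (Fin 3) (Fin 2) E)).restrictScalars 𝒪[E]) →
      (∀ c : E, (Pi.single 1 c : Fin 3 → E) ∈ L₃ ↔ Valued.v c ≤ Valued.v ϖ ^ b) →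
      (∀ k : ℕ, k ≤ 2 * b → k ≤ 2 * mstarOfRecord d → k ≤ b + 1 + mstarOfRecord d → k ≤ tE + mstarOfRecord d →
          LatticeNearTransvShell ϖ 0 k ((((endoGL (γ₂, u) : GL (Fin 3) E) : Matrix (Fin 3) (Fin 3) E) - 1)) L₃) ∧
      ({z : E | ∃ y ∈ L₃, Valued.v ((ϖ ^ mstarOfRecord d)⁻¹ * (z - pairing σ (!![H₂ 0 0, 0, H₂ 0 1; 0, hW, 0; H₂ 1 0, 0, H₂ 1 1] : Matrix (Fin 3) (Fin 3) E) y
          ((((endoGL (γ₂, u) : GL (Fin 3) E) : Matrix (Fin 3) (Fin 3) E) - 1) *ᵥ y))) ≤ 1} = valueSetMod σ ϖ (mstarOfRecord d) (xPlus σ ϖ d) ↔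
        ∃ z : E, z * σ z = fE * hW) := by
    intro Λ hΛ B L₃ hBΛ hL hLB htube
    obtain ⟨x₀, w₀, g₀, hx₀, hΛx, hyO, hyp, hylev, hw₀Y, hpr, hg₀, hg₀1, hprg⟩ :=
      exists_presentation_of_mem_levelSetDep σ hσσ hvσ hϖ hH₂ hH₂σ hhW jE hρρ hvρ hα hα1 hint hΘΘ hΘρ hvΘ hjv hjfix hjpow hϖmax φ hφs hφi hφo hφγ hvlam hΘh hh hform
        ((u : Matrix (Fin 1) (Fin 1) E) 0 0) hb1 hlamj hΛ hBΛ hL hLB htube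
    have hintL : ∀ y ∈ L₃, Valued.v (pairing σ (!![H₂ 0 0, 0, H₂ 0 1; 0, hW, 0; H₂ 1 0, 0, H₂ 1 1] : Matrix (Fin 3) (Fin 3) E) y y) ≤ 1 :=
      fun y hy => (mem_dualLatt σ _ L₃ y).1 (le_dualLatt_of_isVertexLattice hvσ hL hy) y hy
    refine ⟨fun k hk1 hk2 hk3 hk4 => ?_, ?_⟩
    · exact latticeNearTransvShell_zero_of_row hvρ hα hα1 hϖ (le_of_eq h2t) jE hjv hjfix φ hφs hφi hφγ htube hpr hLB.symm hg₀ hg₀1 hprg hBΛ hx₀ hΛx hw₀Y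
        hyO hyp hb1 hylev hcb u hum' hμ2b hanti hk1 hk2 hk3 hk4
    · exact valueSet_rowVertex_eq_xPlus_iff hD hd0 H₂ hhW hhWσ jE hjv hjfix hρρ hvρ hα hα1 hint hΘΘ hΘρ hvΘ hΘj hU hjiso φ hφs hφγ hh hΘh hform hpr hintL
        hLB.symm hg₀ hg₀1 hprg u hum hx₀ hBΛ hΛx hw₀Y hyO hylev hm hjl hb2 hσf hf1 hμf (by omega) hbj hjl'
  -- A WEIGHTED MEMBER HAS A GLUED VERTEX
  have hglue : ∀ Λ ∈ levelSetDep ρ Θ α (jE ϖ) h j b μ, f b j Λ ≠ 0 → ∃ B : Submodule 𝒪[E] (Fin 2 → E), B.toAddSubgroup.map φ = Λ ∧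
      ∃ L₃ : Submodule 𝒪[E] (Fin 3 → E), IsSelfDualLattice σ ϖ (!![H₂ 0 0, 0, H₂ 0 1; 0, hW, 0; H₂ 1 0, 0, H₂ 1 1] : Matrix (Fin 3) (Fin 3) E) L₃ ∧
        L₃ ⊓ LinearMap.ker ((LinearMap.proj (1 : Fin 3) : (Fin 3 → E) →ₗ[E] E).restrictScalars 𝒪[E]) =
          B.map ((Matrix.toLin' (!![1, 0; 0, 0; 0, 1] : Matrix (Fin 3) (Fin 2) E)).restrictScalars 𝒪[E]) ∧
        (∀ c : E, (Pi.single 1 c : Fin 3 → E) ∈ L₃ ↔ Valued.v c ≤ Valued.v ϖ ^ b) := by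
    intro Λ hΛ hfne
    obtain ⟨⟨x₀, hx₀, hΛx, hyO, hyprim, hylev⟩, hdepΛ⟩ := hΛ
    obtain ⟨B, hBΛ, -, -, w₀, -, -, -, -, -⟩ := exists_coneData_of_gen σ hϖ0 hϖlt H₂ jE hρρ hvρ hα hα1 hint hΘΘ hΘρ hvΘ hjv hjfix hjpow hϖmax φ hφs hφi hφo hφγ
      hvlam hΘh hh hform ((u : Matrix (Fin 1) (Fin 1) E) 0 0) hb1 hx₀ hΛx hyO hyprim hylev hdepΛ hlamj
    subst hBΛ
    obtain ⟨r, hr⟩ := exists_map_eq_glueUnit (ρ := ρ) (Θ := Θ) (α := α) jE hρρ hΘρ hjfix (jE ϖ ^ j) h x₀ ϖ hW b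
    have hcount := ncard_glueFibre_eq_natCard_normFibre_of_gen σ hσσ hvσ hϖ hH₂ hH₂σ hhW hhWσ jE hρρ hvρ hα hα1 hint hΘΘ hΘρ hvΘ hΘj hjv hjfix hjpow hϖmax φ hφs hφi
      hφo hφγ hvlam hΘh hh hform ((u : Matrix (Fin 1) (Fin 1) E) 0 0) hb1 hx₀ hΛx hyO hyprim hylev hdepΛ hlamj hr
    rw [hf b j _ x₀ r hb1 hx₀ hΛx hyO hyprim hylev hdepΛ hlamj hr, ← hcount] at hfne
    obtain ⟨L₃, hL, hLB, htube⟩ := Set.nonempty_of_ncard_ne_zero hfne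
    exact ⟨B, rfl, L₃, hL, hLB, htube⟩
  -- FOLD THE CELL
  rw [hd0]
  by_cases hβ : ∃ z : E, z * σ z = fE * hW
  · rw [if_pos hβ, one_mul]
    refine finsum_inter_sub_finsum_inter_eq_of_pure _ _ _ (f b j) (fun Λ hΛ hPQ => ?_) (fun Λ hΛ hfne => ?_)
    · obtain ⟨⟨B, hBΛ, L₃, hL, hLB, htube, -, hlab⟩, ⟨B', hBΛ', L₃', hL', hLB', htube', -, hlab'⟩⟩ := hPQ
      exact hlab' (((hvert Λ hΛ B' L₃' hBΛ' hL' hLB' htube').2).2 hβ)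
    · obtain ⟨B, hBΛ, L₃, hL, hLB, htube⟩ := hglue Λ hΛ hfne
      obtain ⟨hsh, hbit⟩ := hvert Λ hΛ B L₃ hBΛ hL hLB htube
      exact ⟨B, hBΛ, L₃, hL, hLB, htube, hsh _ (by omega) (by omega) (by omega) (by omega), hbit.2 hβ⟩
  · rw [if_neg hβ, neg_one_mul]
    refine finsum_inter_sub_finsum_inter_eq_neg_of_pure _ _ _ (f b j) (fun Λ hΛ hPQ => ?_) (fun Λ hΛ hfne => ?_)
    · obtain ⟨⟨B, hBΛ, L₃, hL, hLB, htube, -, hlab⟩, -⟩ := hPQ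
      exact hβ (((hvert Λ hΛ B L₃ hBΛ hL hLB htube).2).1 hlab)
    · obtain ⟨B, hBΛ, L₃, hL, hLB, htube⟩ := hglue Λ hΛ hfne
      obtain ⟨hsh, hbit⟩ := hvert Λ hΛ B L₃ hBΛ hL hLB htube
      exact ⟨B, hBΛ, L₃, hL, hLB, htube, hsh _ (by omega) (by omega) (by omega) (by omega), fun hlab => hβ (hbit.1 hlab)⟩

end Summit.HodgeConjecture.HodgeConjecture.Cruxes.H413.F0P3cDyRamRowCleanCellBit

end
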